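import Summits.HubbardSuperconductivity.HubbardSuperconductivity.Theorems.SoloBlindFermiSurfaceDOS
import HarnessLib

/-!
# Disjoint dyadic shell windows at the Fermi level (solo-blind programme, Theorem 27, part 2)

Constructive refinement of `SoloBlindFermiSurfaceDOS`: for `μ ∈ [-2, 0]` and `0 < η₀ ≤ 1/2` we
exhibit momentum sets `W⁺_j, W⁻_j` (`j : ℕ`, scale `η_j = η₀/4^j`) with
`#W^±_j = m · ⌈3η_jL/16π - 2⌉₊` for one `m ∈ [L/16π - 2, L/16π]`; every `k ∈ W⁺_j` has
`μ < ε_L(k) ≤ μ + η_j`, every `k ∈ W⁻_j` has `μ - η_j ≤ ε_L(k) < μ`, all have `|w_d(k)| ≥ √2/2`;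
and the `W⁺_j` (resp. `W⁻_j`) are pairwise disjoint (scales in ratio `4` occupy disjoint angular
windows of each column). With trial weights supported on these windows, kinetic cost and pairing
gain of the number-projected BCS state are governed by the same explicit counts — no upper
density-of-states bound is needed for the lattice Cooper logarithm (report §5.20 (6), items
E5a′/E5c; claim C53). [this work; elementary]
-/

noncomputable section

namespace Summit.HubbardSuperconductivity.HubbardSuperconductivity.Theorems.FermiSurfaceDOS

open Finset Real Literature.Probability.LatticeModels Literature.MathematicalPhysics.QuantumLattice

/-- Integers `A, …, A+n-1` in `[x, y-1]` (`0 ≤ x ≤ y`), `y - x - 2 ≤ n ≤ y - x`. [folklore] -/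
theorem exists_nat_window' {x y : ℝ} (hx : 0 ≤ x) (hxy : x ≤ y) :
    ∃ A n : ℕ, y - x - 2 ≤ n ∧ (n : ℝ) ≤ y - x ∧
      ∀ j < n, x ≤ ((A + j : ℕ) : ℝ) ∧ ((A + j : ℕ) : ℝ) + 1 ≤ y := by
  refine ⟨⌈x⌉₊, ⌊y⌋₊ - ⌈x⌉₊, ?_, ?_, ?_⟩
  · have h1 : (⌈x⌉₊ : ℝ) < x + 1 := Nat.ceil_lt_add_one hx
    have h2 : y - 1 < (⌊y⌋₊ : ℝ) := by have := Nat.lt_floor_add_one y; linarith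
    rcases Nat.lt_or_ge ⌊y⌋₊ ⌈x⌉₊ with h | h
    · rw [Nat.sub_eq_zero_of_le h.le, Nat.cast_zero]
      have h3 : (⌊y⌋₊ : ℝ) < ⌈x⌉₊ := by exact_mod_cast h
      linarith
    · rw [Nat.cast_sub h]
      linarith
  · have h1 : x ≤ (⌈x⌉₊ : ℝ) := Nat.le_ceil x
    have h2 : (⌊y⌋₊ : ℝ) ≤ y := Nat.floor_le (hx.trans hxy)
    rcases Nat.lt_or_ge ⌊y⌋₊ ⌈x⌉₊ with h | h
    · rw [Nat.sub_eq_zero_of_le h.le, Nat.cast_zero]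
      linarith
    · rw [Nat.cast_sub h]
      linarith
  · intro j hj
    constructor
    · calc x ≤ ⌈x⌉₊ := Nat.le_ceil x
        _ ≤ ((⌈x⌉₊ + j : ℕ) : ℝ) := by exact_mod_cast Nat.le_add_right _ _
    · have h4 : ⌈x⌉₊ + j + 1 ≤ ⌊y⌋₊ := by omega
      have h5 : ((⌈x⌉₊ + j : ℕ) : ℝ) + 1 ≤ ⌊y⌋₊ := by exact_mod_cast h4
      have h6 : (⌊y⌋₊ : ℝ) ≤ y := Nat.floor_le (hx.trans hxy)
      linarith

/-- `|c| ≤ 7/8`, `θ ∈ [arccos c + η/8, arccos c + η/2]`: `0 < c - cos θ ≤ η/2`, `θ ≤ π`. -/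
theorem above_props {c η θ : ℝ} (hc1 : -7 / 8 ≤ c) (hc2 : c ≤ 7 / 8) (hη0 : 0 < η) (hη1 : η ≤ 1)
    (h1 : Real.arccos c + η / 8 ≤ θ) (h2 : θ ≤ Real.arccos c + η / 2) :
    Real.cos θ < c ∧ c - Real.cos θ ≤ η / 2 ∧ θ ≤ π := by
  have hθs0 : 0 ≤ Real.arccos c := Real.arccos_nonneg c
  have hθsπ : Real.arccos c ≤ π - 1 / 2 := arccos_le_pi_sub_half hc1
  have hcos : Real.cos (Real.arccos c) = c := Real.cos_arccos (by linarith) (by linarith)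
  have hθπ : θ ≤ π := by linarith
  refine ⟨?_, ?_, hθπ⟩
  · rw [← hcos]
    exact Real.cos_lt_cos_of_nonneg_of_le_pi hθs0 hθπ (by linarith)
  · have h := Real.abs_cos_sub_cos_le (Real.arccos c) θ
    rw [hcos, abs_of_nonpos (by linarith : Real.arccos c - θ ≤ 0)] at h
    linarith [le_abs_self (c - Real.cos θ)]

/-- `|c| ≤ 7/8`, `θ ∈ [arccos c - η/2, arccos c - η/8]`: `0 < cos θ - c ≤ η/2`, `0 ≤ θ ≤ π`. -/
theorem below_props {c η θ : ℝ} (hc1 : -7 / 8 ≤ c) (hc2 : c ≤ 7 / 8) (hη0 : 0 < η) (hη1 : η ≤ 1)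
    (h1 : Real.arccos c - η / 2 ≤ θ) (h2 : θ ≤ Real.arccos c - η / 8) :
    c < Real.cos θ ∧ Real.cos θ - c ≤ η / 2 ∧ 0 ≤ θ ∧ θ ≤ π := by
  have hθs0 : 1 / 2 ≤ Real.arccos c := half_le_arccos hc2
  have hθsπ : Real.arccos c ≤ π := Real.arccos_le_pi c
  have hcos : Real.cos (Real.arccos c) = c := Real.cos_arccos (by linarith) (by linarith)
  have hθ0 : 0 ≤ θ := by linarith
  refine ⟨?_, ?_, hθ0, by linarith⟩
  · rw [← hcos]
    exact Real.cos_lt_cos_of_nonneg_of_le_pi hθ0 hθsπ (by linarith)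
  · have h := Real.abs_cos_sub_cos_le θ (Real.arccos c)
    rw [hcos, abs_of_nonpos (by linarith : θ - Real.arccos c ≤ 0)] at h
    linarith [le_abs_self (Real.cos θ - c)]

/-- Window point above the level: column `a` with level `c ∈ [3/4, 7/8]`, residue `b` with
`L(arccos c + η/8)/2π ≤ b ≤ L(arccos c + η/2)/2π - 1`: `μ < ε ≤ μ + η`, `|w_d| ≥ √2/2`. -/
theorem window_point_above {L : ℕ} [NeZero L] {μ η c : ℝ} {a b : ℕ} (hμ1 : -2 ≤ μ)
    (hη0 : 0 < η) (hη1 : η ≤ 1 / 2) (ha : a < L)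
    (hc : c = -Real.cos (2 * π * (a : ℝ) / L) - μ / 2) (hc1 : 3 / 4 ≤ c) (hc2 : c ≤ 7 / 8)
    (hx : L * (Real.arccos c + η / 8) / (2 * π) ≤ b)
    (hy : (b : ℝ) + 1 ≤ L * (Real.arccos c + η / 2) / (2 * π)) :
    b < L ∧ μ < torusBand L (![((a : ℕ) : ZMod L), ((b : ℕ) : ZMod L)] : TorusSite 2 L) ∧
      torusBand L (![((a : ℕ) : ZMod L), ((b : ℕ) : ZMod L)] : TorusSite 2 L) ≤ μ + η ∧
      Real.sqrt 2 / 2 ≤ |pairFieldMode dWaveFormFactor L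
        (![((a : ℕ) : ZMod L), ((b : ℕ) : ZMod L)] : TorusSite 2 L)| := by
  have hL : 0 < L := Nat.pos_of_ne_zero (NeZero.ne L)
  have hLr : (0 : ℝ) < L := by exact_mod_cast hL
  have hθ1 : Real.arccos c + η / 8 ≤ 2 * π * (b : ℝ) / L := by
    rw [le_div_iff₀ hLr]; rw [div_le_iff₀ (by positivity)] at hx; nlinarith
  have hθ2 : 2 * π * (b : ℝ) / L ≤ Real.arccos c + η / 2 := by
    rw [div_le_iff₀ hLr]
    have hy' : (b : ℝ) ≤ L * (Real.arccos c + η / 2) / (2 * π) := by linarith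
    rw [le_div_iff₀ (by positivity)] at hy'; nlinarith
  obtain ⟨hlt, hlip, hθπ⟩ := above_props (by linarith) hc2 hη0 (by linarith) hθ1 hθ2
  have hb : b < L := by
    apply lt_of_two_mul_cast_le hL
    rw [div_le_iff₀ hLr] at hθπ; nlinarith [Real.pi_pos]
  obtain ⟨hband, hprof⟩ := band_and_profile_of_cast (L := L) ha hb
  rw [hc] at hlt hlip hc1
  refine ⟨hb, ?_, ?_, ?_⟩
  · rw [hband]; linarith
  · rw [hband]; linarith
  · rw [hprof]
    exact profile_ge_of_column hμ1 hη1 hc1 (abs_le.2 ⟨by linarith, by linarith⟩)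

/-- Window point below the level (`L(arccos c - η/2)/2π ≤ b ≤ L(arccos c - η/8)/2π - 1`). -/
theorem window_point_below {L : ℕ} [NeZero L] {μ η c : ℝ} {a b : ℕ} (hμ1 : -2 ≤ μ)
    (hη0 : 0 < η) (hη1 : η ≤ 1 / 2) (ha : a < L)
    (hc : c = -Real.cos (2 * π * (a : ℝ) / L) - μ / 2) (hc1 : 3 / 4 ≤ c) (hc2 : c ≤ 7 / 8)
    (hx : L * (Real.arccos c - η / 2) / (2 * π) ≤ b)
    (hy : (b : ℝ) + 1 ≤ L * (Real.arccos c - η / 8) / (2 * π)) :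
    b < L ∧ μ - η ≤ torusBand L (![((a : ℕ) : ZMod L), ((b : ℕ) : ZMod L)] : TorusSite 2 L) ∧
      torusBand L (![((a : ℕ) : ZMod L), ((b : ℕ) : ZMod L)] : TorusSite 2 L) < μ ∧
      Real.sqrt 2 / 2 ≤ |pairFieldMode dWaveFormFactor L
        (![((a : ℕ) : ZMod L), ((b : ℕ) : ZMod L)] : TorusSite 2 L)| := by
  have hL : 0 < L := Nat.pos_of_ne_zero (NeZero.ne L)
  have hLr : (0 : ℝ) < L := by exact_mod_cast hL
  have hθ1 : Real.arccos c - η / 2 ≤ 2 * π * (b : ℝ) / L := by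
    rw [le_div_iff₀ hLr]; rw [div_le_iff₀ (by positivity)] at hx; nlinarith
  have hθ2 : 2 * π * (b : ℝ) / L ≤ Real.arccos c - η / 8 := by
    rw [div_le_iff₀ hLr]
    have hy' : (b : ℝ) ≤ L * (Real.arccos c - η / 8) / (2 * π) := by linarith
    rw [le_div_iff₀ (by positivity)] at hy'; nlinarith
  obtain ⟨hlt, hlip, -, hθπ⟩ := below_props (by linarith) hc2 hη0 (by linarith) hθ1 hθ2
  have hb : b < L := by
    apply lt_of_two_mul_cast_le hL
    rw [div_le_iff₀ hLr] at hθπ; nlinarith [Real.pi_pos]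
  obtain ⟨hband, hprof⟩ := band_and_profile_of_cast (L := L) ha hb
  rw [hc] at hlt hlip hc1
  refine ⟨hb, ?_, ?_, ?_⟩
  · rw [hband]; linarith
  · rw [hband]; linarith
  · rw [hprof]
    exact profile_ge_of_column hμ1 hη1 hc1 (abs_le.2 ⟨by linarith, by linarith⟩)

/-- Scales in ratio `4`: `η₀/4^{j'} ≤ (η₀/4^j)/4` for `j < j'`, `0 ≤ η₀`. [folklore] -/
theorem scale_le_quarter {η₀ : ℝ} (hη : 0 ≤ η₀) {j j' : ℕ} (hjj : j < j') :
    η₀ / 4 ^ j' ≤ η₀ / 4 ^ j / 4 := by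
  rw [div_div, ← pow_succ]
  apply div_le_div_of_nonneg_left hη (by positivity)
  exact pow_le_pow_right₀ (by norm_num) (by omega)

/-- Windows of scales `e' ≤ e/4` around `θ` are ordered. [folklore] -/
theorem quarter_windows {θ e e' M : ℝ} (hM : 0 ≤ M) (h : e' ≤ e / 4) :
    M * (θ + e' / 2) / (2 * π) ≤ M * (θ + e / 8) / (2 * π) ∧
      M * (θ - e / 8) / (2 * π) ≤ M * (θ - e' / 2) / (2 * π) :=
  ⟨div_le_div_of_nonneg_right (mul_le_mul_of_nonneg_left (by linarith) hM) (by positivity),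
    div_le_div_of_nonneg_right (mul_le_mul_of_nonneg_left (by linarith) hM) (by positivity)⟩

/-- **Theorem 27′ (disjoint dyadic shell windows).** See the module docstring. [this work] -/
theorem exists_dyadic_windows (L : ℕ) [NeZero L] (μ : ℝ) (hμ1 : -2 ≤ μ) (hμ2 : μ ≤ 0)
    (η₀ : ℝ) (hη0 : 0 < η₀) (hη1 : η₀ ≤ 1 / 2) :
    ∃ (m : ℕ) (Wp Wm : ℕ → Finset (TorusSite 2 L)),
      L / (16 * π) - 2 ≤ m ∧ (m : ℝ) ≤ L / (16 * π) ∧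
      (∀ j, #(Wp j) = m * ⌈3 * (η₀ / 4 ^ j) * L / (16 * π) - 2⌉₊) ∧
      (∀ j, #(Wm j) = m * ⌈3 * (η₀ / 4 ^ j) * L / (16 * π) - 2⌉₊) ∧
      (∀ j, ∀ k ∈ Wp j, μ < torusBand L k ∧ torusBand L k ≤ μ + η₀ / 4 ^ j ∧
        Real.sqrt 2 / 2 ≤ |pairFieldMode dWaveFormFactor L k|) ∧
      (∀ j, ∀ k ∈ Wm j, μ - η₀ / 4 ^ j ≤ torusBand L k ∧ torusBand L k < μ ∧
        Real.sqrt 2 / 2 ≤ |pairFieldMode dWaveFormFactor L k|) ∧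
      (∀ j j', j ≠ j' → Disjoint (Wp j) (Wp j')) ∧
      (∀ j j', j ≠ j' → Disjoint (Wm j) (Wm j')) := by
  have hL : 0 < L := Nat.pos_of_ne_zero (NeZero.ne L)
  have hLr : (0 : ℝ) < L := by exact_mod_cast hL
  set φ₁ := Real.arccos (-μ / 2 - 3 / 4) with hφ₁
  have hφ0 : 0 ≤ φ₁ := Real.arccos_nonneg _
  have hφπ : φ₁ ≤ π - 1 / 2 := arccos_le_pi_sub_half (by linarith)
  have hcosφ : Real.cos φ₁ = -μ / 2 - 3 / 4 := Real.cos_arccos (by linarith) (by linarith)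
  obtain ⟨A, m, hm, hm', hcolw⟩ := exists_nat_window' (x := L * φ₁ / (2 * π))
    (y := L * (φ₁ + 1 / 8) / (2 * π)) (by positivity)
    (by apply div_le_div_of_nonneg_right _ (by positivity); nlinarith)
  have hlen : L * (φ₁ + 1 / 8) / (2 * π) - L * φ₁ / (2 * π) = L / (16 * π) := by
    field_simp; ring
  -- column levels `c i ∈ [3/4, 7/8]` and scales `η j = η₀ / 4^j`, as opaque functions
  obtain ⟨c, hc⟩ : ∃ c : ℕ → ℝ, ∀ i, c i = -Real.cos (2 * π * ((A + i : ℕ) : ℝ) / L) - μ / 2 :=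
    ⟨_, fun _ => rfl⟩
  obtain ⟨η, hη⟩ : ∃ η : ℕ → ℝ, ∀ j, η j = η₀ / 4 ^ j := ⟨_, fun _ => rfl⟩
  have hηpos : ∀ j, 0 < η j := fun j => by rw [hη j]; positivity
  have hηle : ∀ j, η j ≤ 1 / 2 := fun j => by
    rw [hη j]; exact (div_le_self hη0.le (one_le_pow₀ (by norm_num))).trans hη1
  have hcol : ∀ i < m, A + i < L ∧ 3 / 4 ≤ c i ∧ c i ≤ 7 / 8 := by
    intro i hi
    obtain ⟨hx, hy⟩ := hcolw i hi
    rw [hc i]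
    have hφ1' : φ₁ ≤ 2 * π * ((A + i : ℕ) : ℝ) / L := by
      rw [le_div_iff₀ hLr]; rw [div_le_iff₀ (by positivity)] at hx; nlinarith
    have hφ2' : 2 * π * ((A + i : ℕ) : ℝ) / L ≤ φ₁ + 1 / 8 := by
      rw [div_le_iff₀ hLr]
      have hy' : ((A + i : ℕ) : ℝ) ≤ L * (φ₁ + 1 / 8) / (2 * π) := by linarith
      rw [le_div_iff₀ (by positivity)] at hy'; nlinarith
    have hφπ' : 2 * π * ((A + i : ℕ) : ℝ) / L ≤ π := by linarith
    have hle := Real.cos_le_cos_of_nonneg_of_le_pi hφ0 hφπ' hφ1'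
    have hlip : Real.cos φ₁ - Real.cos (2 * π * ((A + i : ℕ) : ℝ) / L) ≤ 1 / 8 := by
      have h := Real.abs_cos_sub_cos_le φ₁ (2 * π * ((A + i : ℕ) : ℝ) / L)
      rw [abs_of_nonpos (by linarith : φ₁ - 2 * π * ((A + i : ℕ) : ℝ) / L ≤ 0)] at h
      linarith [le_abs_self (Real.cos φ₁ - Real.cos (2 * π * ((A + i : ℕ) : ℝ) / L))]
    refine ⟨?_, ?_, ?_⟩
    · apply lt_of_two_mul_cast_le hL
      rw [div_le_iff₀ hLr] at hφπ'; nlinarith [Real.pi_pos]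
    · rw [hcosφ] at hle; linarith
    · rw [hcosφ] at hlip; linarith
  have hθ_half : ∀ i < m, 1 / 2 ≤ Real.arccos (c i) := fun i hi => half_le_arccos (hcol i hi).2.2
  have keyP : ∀ i j : ℕ, ∃ A₂ n : ℕ, (i < m →
      (L * (Real.arccos (c i) + η j / 2) / (2 * π) -
          L * (Real.arccos (c i) + η j / 8) / (2 * π) - 2 ≤ n ∧
      ∀ b < n, L * (Real.arccos (c i) + η j / 8) / (2 * π) ≤ ((A₂ + b : ℕ) : ℝ) ∧
        ((A₂ + b : ℕ) : ℝ) + 1 ≤ L * (Real.arccos (c i) + η j / 2) / (2 * π))) := by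
    intro i j
    by_cases hi : i < m
    · have hx0 : 0 ≤ L * (Real.arccos (c i) + η j / 8) / (2 * π) := by
        have := Real.arccos_nonneg (c i); have := hηpos j; positivity
      have hxy : L * (Real.arccos (c i) + η j / 8) / (2 * π) ≤
          L * (Real.arccos (c i) + η j / 2) / (2 * π) := div_le_div_of_nonneg_right
        (mul_le_mul_of_nonneg_left (by linarith [hηpos j]) hLr.le) (by positivity)
      obtain ⟨A₂, n, h1, -, h3⟩ := exists_nat_window' hx0 hxy
      exact ⟨A₂, n, fun _ => ⟨h1, h3⟩⟩
    · exact ⟨0, 0, fun h => absurd h hi⟩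
  have keyM : ∀ i j : ℕ, ∃ A₂ n : ℕ, (i < m →
      (L * (Real.arccos (c i) - η j / 8) / (2 * π) -
          L * (Real.arccos (c i) - η j / 2) / (2 * π) - 2 ≤ n ∧
      ∀ b < n, L * (Real.arccos (c i) - η j / 2) / (2 * π) ≤ ((A₂ + b : ℕ) : ℝ) ∧
        ((A₂ + b : ℕ) : ℝ) + 1 ≤ L * (Real.arccos (c i) - η j / 8) / (2 * π))) := by
    intro i j
    by_cases hi : i < m
    · have hx0 : 0 ≤ L * (Real.arccos (c i) - η j / 2) / (2 * π) := by
        apply div_nonneg _ (by positivity)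
        apply mul_nonneg hLr.le
        linarith [hθ_half i hi, hηle j]
      have hxy : L * (Real.arccos (c i) - η j / 2) / (2 * π) ≤
          L * (Real.arccos (c i) - η j / 8) / (2 * π) := div_le_div_of_nonneg_right
        (mul_le_mul_of_nonneg_left (by linarith [hηpos j]) hLr.le) (by positivity)
      obtain ⟨A₂, n, h1, -, h3⟩ := exists_nat_window' hx0 hxy
      exact ⟨A₂, n, fun _ => ⟨h1, h3⟩⟩
    · exact ⟨0, 0, fun h => absurd h hi⟩
  choose Ap np hP using keyP
  choose Am nm hM using keyM
  have hlenP : ∀ i j, L * (Real.arccos (c i) + η j / 2) / (2 * π) -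
      L * (Real.arccos (c i) + η j / 8) / (2 * π) = 3 * (η₀ / 4 ^ j) * L / (16 * π) := by
    intro i j; rw [hη j]; field_simp; ring
  have hlenM : ∀ i j, L * (Real.arccos (c i) - η j / 8) / (2 * π) -
      L * (Real.arccos (c i) - η j / 2) / (2 * π) = 3 * (η₀ / 4 ^ j) * L / (16 * π) := by
    intro i j; rw [hη j]; field_simp; ring
  set N₀ : ℕ → ℕ := fun j => ⌈3 * (η₀ / 4 ^ j) * L / (16 * π) - 2⌉₊ with hN₀
  have hN₀P : ∀ i < m, ∀ j, N₀ j ≤ np i j := fun i hi j =>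
    Nat.ceil_le.mpr (by rw [← hlenP i j]; exact ((hP i j) hi).1)
  have hN₀M : ∀ i < m, ∀ j, N₀ j ≤ nm i j := fun i hi j =>
    Nat.ceil_le.mpr (by rw [← hlenM i j]; exact ((hM i j) hi).1)
  have hwinP : ∀ i < m, ∀ j, ∀ b < np i j, Ap i j + b < L ∧
      μ < torusBand L (![(((A + i : ℕ)) : ZMod L), (((Ap i j + b : ℕ)) : ZMod L)] :
        TorusSite 2 L) ∧
      torusBand L (![(((A + i : ℕ)) : ZMod L), (((Ap i j + b : ℕ)) : ZMod L)] :
        TorusSite 2 L) ≤ μ + η j ∧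
      Real.sqrt 2 / 2 ≤ |pairFieldMode dWaveFormFactor L
        (![(((A + i : ℕ)) : ZMod L), (((Ap i j + b : ℕ)) : ZMod L)] : TorusSite 2 L)| := by
    intro i hi j b hb
    obtain ⟨hx, hy⟩ := ((hP i j) hi).2 b hb
    exact window_point_above hμ1 (hηpos j) (hηle j) (hcol i hi).1 (hc i) (hcol i hi).2.1
      (hcol i hi).2.2 hx hy
  have hwinM : ∀ i < m, ∀ j, ∀ b < nm i j, Am i j + b < L ∧
      μ - η j ≤ torusBand L (![(((A + i : ℕ)) : ZMod L), (((Am i j + b : ℕ)) : ZMod L)] :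
        TorusSite 2 L) ∧
      torusBand L (![(((A + i : ℕ)) : ZMod L), (((Am i j + b : ℕ)) : ZMod L)] :
        TorusSite 2 L) < μ ∧
      Real.sqrt 2 / 2 ≤ |pairFieldMode dWaveFormFactor L
        (![(((A + i : ℕ)) : ZMod L), (((Am i j + b : ℕ)) : ZMod L)] : TorusSite 2 L)| := by
    intro i hi j b hb
    obtain ⟨hx, hy⟩ := ((hM i j) hi).2 b hb
    exact window_point_below hμ1 (hηpos j) (hηle j) (hcol i hi).1 (hc i) (hcol i hi).2.1
      (hcol i hi).2.2 hx hy
  let fP : ℕ → ℕ × ℕ → TorusSite 2 L := fun j ib =>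
    ![(((A + ib.1 : ℕ)) : ZMod L), (((Ap ib.1 j + ib.2 : ℕ)) : ZMod L)]
  let fM : ℕ → ℕ × ℕ → TorusSite 2 L := fun j ib =>
    ![(((A + ib.1 : ℕ)) : ZMod L), (((Am ib.1 j + ib.2 : ℕ)) : ZMod L)]
  have hmemD : ∀ {j i b : ℕ}, (i, b) ∈ (range m ×ˢ range (N₀ j) : Finset (ℕ × ℕ)) →
      i < m ∧ b < N₀ j := by
    intro j i b h
    rwa [mem_product, mem_range, mem_range] at h
  have hcompP : ∀ {j j' i b i' b' : ℕ}, i < m → b < np i j → i' < m → b' < np i' j' →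
      fP j (i, b) = fP j' (i', b') → i = i' ∧ Ap i j + b = Ap i' j' + b' := by
    intro j j' i b i' b' hi hb hi' hb' heq
    have h0 := congr_fun heq 0
    have h1 := congr_fun heq 1
    simp only [fP, Matrix.cons_val_zero, Matrix.cons_val_one, Matrix.cons_val_fin_one] at h0 h1
    have h0' := congr_arg ZMod.val h0
    rw [ZMod.val_cast_of_lt (hcol i hi).1, ZMod.val_cast_of_lt (hcol i' hi').1] at h0'
    have hii : i = i' := by omega
    subst hii
    have h1' := congr_arg ZMod.val h1
    rw [ZMod.val_cast_of_lt (hwinP i hi j b hb).1, ZMod.val_cast_of_lt (hwinP i hi j' b' hb').1]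
      at h1'
    exact ⟨rfl, h1'⟩
  have hcompM : ∀ {j j' i b i' b' : ℕ}, i < m → b < nm i j → i' < m → b' < nm i' j' →
      fM j (i, b) = fM j' (i', b') → i = i' ∧ Am i j + b = Am i' j' + b' := by
    intro j j' i b i' b' hi hb hi' hb' heq
    have h0 := congr_fun heq 0
    have h1 := congr_fun heq 1
    simp only [fM, Matrix.cons_val_zero, Matrix.cons_val_one, Matrix.cons_val_fin_one] at h0 h1
    have h0' := congr_arg ZMod.val h0
    rw [ZMod.val_cast_of_lt (hcol i hi).1, ZMod.val_cast_of_lt (hcol i' hi').1] at h0'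
    have hii : i = i' := by omega
    subst hii
    have h1' := congr_arg ZMod.val h1
    rw [ZMod.val_cast_of_lt (hwinM i hi j b hb).1, ZMod.val_cast_of_lt (hwinM i hi j' b' hb').1]
      at h1'
    exact ⟨rfl, h1'⟩
  have hinjP : ∀ j, Set.InjOn (fP j) (range m ×ˢ range (N₀ j) : Finset (ℕ × ℕ)) := by
    rintro j ⟨i, b⟩ h ⟨i', b'⟩ h' heq
    obtain ⟨hi, hb⟩ := hmemD (mem_coe.1 h)
    obtain ⟨hi', hb'⟩ := hmemD (mem_coe.1 h')
    obtain ⟨hii, hbb⟩ := hcompP hi (lt_of_lt_of_le hb (hN₀P i hi j)) hi'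
      (lt_of_lt_of_le hb' (hN₀P i' hi' j)) heq
    subst hii
    have : b = b' := by omega
    rw [this]
  have hinjM : ∀ j, Set.InjOn (fM j) (range m ×ˢ range (N₀ j) : Finset (ℕ × ℕ)) := by
    rintro j ⟨i, b⟩ h ⟨i', b'⟩ h' heq
    obtain ⟨hi, hb⟩ := hmemD (mem_coe.1 h)
    obtain ⟨hi', hb'⟩ := hmemD (mem_coe.1 h')
    obtain ⟨hii, hbb⟩ := hcompM hi (lt_of_lt_of_le hb (hN₀M i hi j)) hi'
      (lt_of_lt_of_le hb' (hN₀M i' hi' j)) heq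
    subst hii
    have : b = b' := by omega
    rw [this]
  refine ⟨m, fun j => (range m ×ˢ range (N₀ j)).image (fP j),
    fun j => (range m ×ˢ range (N₀ j)).image (fM j), ?_, ?_, ?_, ?_, ?_, ?_, ?_, ?_⟩
  · rw [hlen] at hm; exact hm
  · rw [hlen] at hm'; exact hm'
  · intro j
    rw [card_image_of_injOn (hinjP j), card_product, card_range, card_range]
  · intro j
    rw [card_image_of_injOn (hinjM j), card_product, card_range, card_range]
  · intro j k hk
    rw [mem_image] at hk
    obtain ⟨⟨i, b⟩, hib, rfl⟩ := hk
    obtain ⟨hi, hb⟩ := hmemD hib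
    have h := (hwinP i hi j b (lt_of_lt_of_le hb (hN₀P i hi j))).2
    rw [hη j] at h
    exact h
  · intro j k hk
    rw [mem_image] at hk
    obtain ⟨⟨i, b⟩, hib, rfl⟩ := hk
    obtain ⟨hi, hb⟩ := hmemD hib
    have h := (hwinM i hi j b (lt_of_lt_of_le hb (hN₀M i hi j))).2
    rw [hη j] at h
    exact h
  · intro j j' hjj
    rw [Finset.disjoint_left]
    intro k hk hk'
    rw [mem_image] at hk hk'
    obtain ⟨⟨i, b⟩, hib, rfl⟩ := hk
    obtain ⟨⟨i', b'⟩, hib', heq⟩ := hk'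
    obtain ⟨hi, hb⟩ := hmemD hib
    obtain ⟨hi', hb'⟩ := hmemD hib'
    have hbn : b < np i j := lt_of_lt_of_le hb (hN₀P i hi j)
    have hbn' : b' < np i' j' := lt_of_lt_of_le hb' (hN₀P i' hi' j')
    obtain ⟨hii, hres⟩ := hcompP hi' hbn' hi hbn heq
    subst hii
    obtain ⟨hx, hy⟩ := ((hP i' j) hi).2 b hbn
    obtain ⟨hx', hy'⟩ := ((hP i' j') hi).2 b' hbn'
    have hcast : ((Ap i' j' + b' : ℕ) : ℝ) = ((Ap i' j + b : ℕ) : ℝ) := by exact_mod_cast hres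
    rcases lt_or_gt_of_ne hjj with hlt | hlt
    · have hq := scale_le_quarter hη0.le hlt
      rw [← hη j, ← hη j'] at hq
      linarith [(quarter_windows (θ := Real.arccos (c i')) hLr.le hq).1]
    · have hq := scale_le_quarter hη0.le hlt
      rw [← hη j, ← hη j'] at hq
      linarith [(quarter_windows (θ := Real.arccos (c i')) hLr.le hq).1]
  · intro j j' hjj
    rw [Finset.disjoint_left]
    intro k hk hk'
    rw [mem_image] at hk hk'
    obtain ⟨⟨i, b⟩, hib, rfl⟩ := hk
    obtain ⟨⟨i', b'⟩, hib', heq⟩ := hk'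
    obtain ⟨hi, hb⟩ := hmemD hib
    obtain ⟨hi', hb'⟩ := hmemD hib'
    have hbn : b < nm i j := lt_of_lt_of_le hb (hN₀M i hi j)
    have hbn' : b' < nm i' j' := lt_of_lt_of_le hb' (hN₀M i' hi' j')
    obtain ⟨hii, hres⟩ := hcompM hi' hbn' hi hbn heq
    subst hii
    obtain ⟨hx, hy⟩ := ((hM i' j) hi).2 b hbn
    obtain ⟨hx', hy'⟩ := ((hM i' j') hi).2 b' hbn'
    have hcast : ((Am i' j' + b' : ℕ) : ℝ) = ((Am i' j + b : ℕ) : ℝ) := by exact_mod_cast hres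
    rcases lt_or_gt_of_ne hjj with hlt | hlt
    · have hq := scale_le_quarter hη0.le hlt
      rw [← hη j, ← hη j'] at hq
      linarith [(quarter_windows (θ := Real.arccos (c i')) hLr.le hq).2]
    · have hq := scale_le_quarter hη0.le hlt
      rw [← hη j, ← hη j'] at hq
      linarith [(quarter_windows (θ := Real.arccos (c i')) hLr.le hq).2]

end Summit.HubbardSuperconductivity.HubbardSuperconductivity.Theorems.FermiSurfaceDOS
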